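import Literature.Topology.FourManifolds.RegularFamilyIsotopy
import Mathlib.MeasureTheory.Integral.IntervalIntegral.FundThmCalculus
import HarnessLib

/-!
# A regular family of compact domains is carried by the flow of ANY transverse field
# (directed form of the isotopy lemma, with its conserved quantities)

Topic `Literature/Topology/FourManifolds`; a proofs-only companion of
`RegularFamilyIsotopy.lean` (**everything in this file is proved; no definitions, no named
facts**).

`RegularFamily.exists_diffeomorph_image_eq` integrates the normalised GRADIENT field
`-χ(F_τ) ∂_τF_τ ∇F_τ/‖∇F_τ‖²` of a regular family `F : ℝ × E → ℝ` of defining functions and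
obtains a diffeomorphism `Φ` of `E` with `Φ {F₀ ≤ 0} = {F₁ ≤ 0}`.  Milnor's proof of
"`Mᵃ` is diffeomorphic to `Mᵇ`" (*Morse theory* (1963), Thm. 3.1) and Hirsch's isotopy lemma
(*Differential Topology* (1976), Ch. 8 §1) use the gradient only through ONE property: it is
transverse to the moving hypersurfaces.  This file runs the same argument with the gradient
replaced by an arbitrary smooth field `Y` on `E` which is transverse to the zero sets,
`dF_τ(Y) ≠ 0` on `{F_τ = 0}` (`τ ∈ [0, 1]`): the field integrated is
`X = -χ(F_τ) ∂_τF_τ · Y / dF_τ(Y)`, a pointwise multiple of `Y`, so that **every point moves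
along its own `Y`-orbit**.  Consequently every conserved quantity of `Y` is preserved by `Φ`,
and every "eigenfunction" `f` of `Y` (`df(Y) = a · f`) is multiplied by a positive scalar —
e.g. for a complex-valued `w` with `dw(Y) = -μ w` the diffeomorphism preserves the hypersurface
`{w = 0}` and the argument `w/‖w‖`.  Moreover transversality is only needed where the
hypersurface actually MOVES: if `∂_τF = 0` off a closed set `C` (for `τ ∈ [0, 1]`), it
suffices that `dF_τ(Y) ≠ 0` on `C ∩ {F_τ = 0}` (the `_on` variants; e.g. a field tangent to the
fibres of `w`, which conserves `w` exactly but is tangent to any part of the hypersurface that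
is a union of fibres — admissible as long as that part does not move).  (Use, fact seat of
`Literature.Geometry.Symplectic.palf_stein_supportedByBoundaryOpenBook`, base case, design note in
`Literature/Geometry/Symplectic/LefschetzSteinRealisationReduction.lean`: identify the Lefschetz
base `Base g = {rho ≤ 1/4} ⊂ ℂ²` with a strictly pseudoconvex model `{Ψ ≤ 1/4}` by a
diffeomorphism preserving the page angle `arg w` and the binding `{w = 0}`, i.e. carrying the Kas
open book of `∂ Base g` to the explicit open book `({w = 0}, w/‖w‖)` of the model; the induced
diffeomorphism of the regular sublevel manifolds is then `RegularSublevel.mapDiffeomorph` composed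
with `RegularSublevel.diffeomorphOfPreimageEq`.)

## Contents

* §1 `RegularFamily.exists_forall_le_abs_fderiv_apply_on`,
  `RegularFamily.exists_forall_le_abs_fderiv_apply` — uniform transversality near the zero
  sets: `|dF_τ(x)(Y x)| ≥ μ > 0` whenever `τ ∈ [0, 1]`, `x ∈ C` and `|F_τ x| ≤ ε` (compactness;
  `C` closed, resp. `C = univ`);
* §2 two ODE lemmas on curves directed by `Y` (`γ' = κ(t) • Y(γ)`):
  `RegularFamily.apply_eq_apply_of_hasDerivAt_smul` — a differentiable `f` with `df(Y) = 0` is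
  constant along `γ`; `RegularFamily.exists_pos_apply_eq_smul_of_hasDerivAt_smul` — a
  differentiable `f` with `df_x(Y x) = a(x) • f(x)` satisfies `f(γ t) = r • f(γ 0)` with
  `r = exp ∫₀ᵗ κ a(γ) > 0`;
* §3 `RegularFamily.exists_diffeomorph_sign_eq_of_field_on` — the directed isotopy lemma (sign
  form) with a closed MOVING SET `C` (`∂_τF = 0` off `C`, transversality on `C ∩ {F_τ = 0}`)
  and the ORBIT CLAUSE: for every `x` there are a curve `γ` and a continuous `κ` with `γ 0 = x`,
  `γ 1 = Φ x`, `γ' = κ • Y ∘ γ`; `RegularFamily.exists_diffeomorph_sign_eq_of_field` — the case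
  `C = univ`; `RegularFamily.exists_diffeomorph_image_eq_of_field_on`,
  `RegularFamily.exists_diffeomorph_image_eq_of_field` — image forms;
  `RegularFamily.exists_diffeomorph_image_eq_of_field_of_eigen` — the packaged form "images +
  conserved quantities + one eigenfunction".

## Proof

Verbatim the proof of `RegularFamilyIsotopy.lean` (reparametrise by `Real.smoothTransition`,
plateau cutoff `χ`, uniform constant from §1, compactly supported smooth field, the tree's
time-dependent flow `Literature.Analysis.ODE.tdFlow` and the clopen/barrier lemmas
`RegularFamily.eq_of_hasDerivAt_mul_one_sub`, `…le_of…`, `…le_neg_of…` along flow lines, on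
which `g(τ) = G(τ, γ τ)` again satisfies `g' = ∂_τG (1 - χ(g))` because
`dG(X) = -χ ∂_τG · dG(Y)/dG(Y)`); the orbit clause is the flow line itself, and §2 is the
scalar linear ODE `u' = k(t) u` solved by the integrating factor `exp(-∫₀ᵗ k)`.

## References

* J. Milnor, *Morse theory*, Ann. of Math. Studies 51 (1963), Thm. 3.1 (any field `X` with
  `X(f) = 1` near `f⁻¹[a, b]` will do). [Milnor1963]
* M. W. Hirsch, *Differential Topology*, GTM 33 (1976), Ch. 8 §1, Thms. 1.1–1.2; Ch. 6 §2
  (regular interval theorem via a transverse field). [HirschDT1976]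
-/

open scoped Topology Manifold ContDiff
open Set Filter Metric Function

noncomputable section

namespace Literature.Topology.FourManifolds

namespace RegularFamily

variable {E : Type*} [NormedAddCommGroup E] [NormedSpace ℝ E]

/-! ### §1 Uniform transversality near the zero sets -/

section Uniform

/-- **Uniform transversality of a compact family to a field, along a closed set.**  If for
every `τ ∈ [0, 1]` the derivative of `F_τ = F(τ, ·)` does not vanish on the vector `Y x` at the
points `x ∈ C` of its zero set (`C` closed), and `{|F_τ| ≤ ε₀} ⊆ K` for a compact `K`, then
`|DF_τ(x)(Y x)| ≥ μ > 0` whenever `τ ∈ [0, 1]`, `x ∈ C` and `|F_τ(x)| ≤ ε`, for some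
`μ, ε > 0`. [folklore] -/
theorem exists_forall_le_abs_fderiv_apply_on {F : ℝ × E → ℝ} (hF : ContDiff ℝ 1 F) {Y : E → E}
    (hY : Continuous Y) {K : Set E} (hK : IsCompact K) {C : Set E} (hC : IsClosed C) {ε₀ : ℝ}
    (hε₀ : 0 < ε₀) (hKF : ∀ τ ∈ Icc (0 : ℝ) 1, ∀ x, |F (τ, x)| ≤ ε₀ → x ∈ K)
    (hreg : ∀ τ ∈ Icc (0 : ℝ) 1, ∀ x ∈ C, F (τ, x) = 0 →
      fderiv ℝ (fun y => F (τ, y)) x (Y x) ≠ 0) :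
    ∃ μ, 0 < μ ∧ ∃ ε, 0 < ε ∧ ε ≤ ε₀ ∧ ∀ τ ∈ Icc (0 : ℝ) 1, ∀ x ∈ C, |F (τ, x)| ≤ ε →
      μ ≤ |fderiv ℝ (fun y => F (τ, y)) x (Y x)| := by
  have hFc : Continuous F := hF.continuous
  -- the spatial derivative as a continuous function of `(τ, x)`
  have hD : ∀ p : ℝ × E, fderiv ℝ (fun y => F (p.1, y)) p.2 =
      (fderiv ℝ F p).comp (ContinuousLinearMap.inr ℝ ℝ E) := by
    intro p
    have h := (hF.differentiable one_ne_zero (p.1, p.2)).hasFDerivAt.comp p.2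
      (hasFDerivAt_prodMk_right (𝕜 := ℝ) p.1 p.2)
    exact h.fderiv
  have hDc : Continuous fun p : ℝ × E => fderiv ℝ (fun y => F (p.1, y)) p.2 := by
    have : (fun p : ℝ × E => fderiv ℝ (fun y => F (p.1, y)) p.2) =
        fun p => (fderiv ℝ F p).comp (ContinuousLinearMap.inr ℝ ℝ E) := funext hD
    rw [this]
    exact ((ContinuousLinearMap.compL ℝ E (ℝ × E) ℝ).flip
      (ContinuousLinearMap.inr ℝ ℝ E)).continuous.comp (hF.continuous_fderiv one_ne_zero)
  -- the directional derivative `dF_τ(x)(Y x)` as a continuous function of `(τ, x)`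
  set d : ℝ × E → ℝ := fun p => fderiv ℝ (fun y => F (p.1, y)) p.2 (Y p.2) with hd
  have hdc : Continuous d := hDc.clm_apply (hY.comp continuous_snd)
  set S : Set (ℝ × E) := Icc (0 : ℝ) 1 ×ˢ (K ∩ C) with hS
  have hSc : IsCompact S := isCompact_Icc.prod (hK.inter_right hC)
  set Z : Set (ℝ × E) := S ∩ F ⁻¹' {0} with hZ
  have hZc : IsCompact Z := hSc.inter_right (isClosed_singleton.preimage hFc)
  obtain ⟨μ, hμ, hμZ⟩ : ∃ μ, 0 < μ ∧ ∀ p ∈ Z, 2 * μ ≤ |d p| := by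
    by_cases hne : Z.Nonempty
    · obtain ⟨p₀, hp₀, hmin⟩ := hZc.exists_isMinOn hne (continuous_abs.comp hdc).continuousOn
      have hpos : 0 < |d p₀| := abs_pos.2 (hreg p₀.1 hp₀.1.1 p₀.2 hp₀.1.2.2 hp₀.2)
      exact ⟨|d p₀| / 2, by positivity, fun p hp => by
        have h' : |d p₀| ≤ |d p| := hmin hp
        linarith⟩
    · exact ⟨1, one_pos, fun p hp => (hne ⟨p, hp⟩).elim⟩
  obtain ⟨ε, hε, hsub⟩ := ExpHeight.exists_pos_inter_subset hSc
    (isOpen_lt continuous_const (continuous_abs.comp hdc)) (P := fun ε => {p | |F p| ≤ ε})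
    (fun ε _ => isClosed_le (continuous_abs.comp hFc) continuous_const)
    (fun ε ε' _ h p hp => le_trans (show |F p| ≤ ε from hp) h)
    (fun p hpS hall => by
      have hp0 : F p = 0 := by
        by_contra h0
        have hpos : 0 < |F p| := abs_pos.2 h0
        have h' : |F p| ≤ |F p| / 2 := hall (|F p| / 2) (by positivity)
        linarith
      have := hμZ p ⟨hpS, hp0⟩
      show μ < |d p|
      linarith)
  refine ⟨μ, hμ, min ε ε₀, lt_min hε hε₀, min_le_right _ _, fun τ hτ x hxC hx => ?_⟩
  have hxK : x ∈ K := hKF τ hτ x (hx.trans (min_le_right _ _))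
  exact le_of_lt (hsub ⟨⟨hτ, hxK, hxC⟩, hx.trans (min_le_left _ _)⟩)

/-- **Uniform transversality of a compact family to a field.**  If for every `τ ∈ [0, 1]` the
derivative of `F_τ = F(τ, ·)` does not vanish on the vector `Y x` at the points `x` of its zero
set, and `{|F_τ| ≤ ε₀} ⊆ K` for a compact `K`, then `|DF_τ(x)(Y x)| ≥ μ > 0` whenever
`τ ∈ [0, 1]` and `|F_τ(x)| ≤ ε`, for some `μ, ε > 0`. [folklore] -/
theorem exists_forall_le_abs_fderiv_apply {F : ℝ × E → ℝ} (hF : ContDiff ℝ 1 F) {Y : E → E}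
    (hY : Continuous Y) {K : Set E} (hK : IsCompact K) {ε₀ : ℝ} (hε₀ : 0 < ε₀)
    (hKF : ∀ τ ∈ Icc (0 : ℝ) 1, ∀ x, |F (τ, x)| ≤ ε₀ → x ∈ K)
    (hreg : ∀ τ ∈ Icc (0 : ℝ) 1, ∀ x, F (τ, x) = 0 → fderiv ℝ (fun y => F (τ, y)) x (Y x) ≠ 0) :
    ∃ μ, 0 < μ ∧ ∃ ε, 0 < ε ∧ ε ≤ ε₀ ∧ ∀ τ ∈ Icc (0 : ℝ) 1, ∀ x, |F (τ, x)| ≤ ε →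
      μ ≤ |fderiv ℝ (fun y => F (τ, y)) x (Y x)| := by
  obtain ⟨μ, hμ, ε, hε, hεε₀, h⟩ := exists_forall_le_abs_fderiv_apply_on hF hY hK isClosed_univ
    hε₀ hKF (fun τ hτ x _ hx => hreg τ hτ x hx)
  exact ⟨μ, hμ, ε, hε, hεε₀, fun τ hτ x hx => h τ hτ x (mem_univ x) hx⟩

end Uniform

/-! ### §2 Conserved quantities and eigenfunctions along directed curves -/

section Invariants

variable {V : Type*} [NormedAddCommGroup V] [NormedSpace ℝ V]

/-- **Conserved quantities.**  If `df_x(Y x) = 0` for all `x` and `γ' = κ(t) • Y(γ)`, then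
`f ∘ γ` is constant. [folklore] -/
theorem apply_eq_apply_of_hasDerivAt_smul {f : E → V} (hf : Differentiable ℝ f) {Y : E → E}
    (hfY : ∀ x, fderiv ℝ f x (Y x) = 0) {γ : ℝ → E} {κ : ℝ → ℝ}
    (hγ : ∀ t, HasDerivAt γ (κ t • Y (γ t)) t) (t : ℝ) : f (γ t) = f (γ 0) := by
  have hu : ∀ s, HasDerivAt (f ∘ γ) 0 s := by
    intro s
    have h := (hf (γ s)).hasFDerivAt.comp_hasDerivAt s (hγ s)
    rwa [map_smul, hfY, smul_zero] at h
  have hdiff : Differentiable ℝ (f ∘ γ) := fun s => (hu s).differentiableAt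
  exact is_const_of_deriv_eq_zero hdiff (fun s => (hu s).deriv) t 0

/-- **Eigenfunctions are multiplied by a positive scalar.**  If `df_x(Y x) = a(x) • f(x)` for all
`x` (`a` continuous) and `γ' = κ(t) • Y(γ)` with `κ` continuous, then
`f(γ t) = exp(∫₀ᵗ κ(s) a(γ s) ds) • f(γ 0)`; in particular `f(γ t) = r • f(γ 0)` with `r > 0`
(the zero set of `f` and the ray `ℝ_{>0} f` are invariant). [folklore] -/
theorem exists_pos_apply_eq_smul_of_hasDerivAt_smul {f : E → V} (hf : Differentiable ℝ f)
    {Y : E → E} {a : E → ℝ} (ha : Continuous a) (hfY : ∀ x, fderiv ℝ f x (Y x) = a x • f x)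
    {γ : ℝ → E} {κ : ℝ → ℝ} (hκ : Continuous κ) (hγ : ∀ t, HasDerivAt γ (κ t • Y (γ t)) t)
    (t : ℝ) : ∃ r : ℝ, 0 < r ∧ f (γ t) = r • f (γ 0) := by
  have hγc : Continuous γ := continuous_iff_continuousAt.2 fun s => (hγ s).continuousAt
  -- the coefficient `k = κ · a ∘ γ` and its primitive `P`
  set k : ℝ → ℝ := fun s => κ s * a (γ s) with hk
  have hkc : Continuous k := hκ.mul (ha.comp hγc)
  set P : ℝ → ℝ := fun s => ∫ σ in (0 : ℝ)..s, k σ with hP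
  have hPd : ∀ s, HasDerivAt P (k s) s := fun s => (hkc.integral_hasStrictDerivAt 0 s).hasDerivAt
  have hP0 : P 0 = 0 := by simp [hP]
  -- `u = f ∘ γ` solves `u' = k u`
  have hu : ∀ s, HasDerivAt (f ∘ γ) (k s • f (γ s)) s := by
    intro s
    have h := (hf (γ s)).hasFDerivAt.comp_hasDerivAt s (hγ s)
    rwa [map_smul, hfY, smul_smul] at h
  -- the integrating factor: `v = exp(-P) • u` is constant
  set v : ℝ → V := fun s => Real.exp (-P s) • f (γ s) with hv
  have hv' : ∀ s, HasDerivAt v 0 s := by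
    intro s
    have h1 : HasDerivAt (fun σ => Real.exp (-P σ)) (Real.exp (-P s) * -k s) s :=
      (hPd s).neg.exp
    have h2 := h1.smul (hu s)
    have hzero : (Real.exp (-P s) * -k s) • f (γ s) + Real.exp (-P s) • k s • f (γ s) = 0 := by
      rw [smul_smul, ← add_smul]
      have : Real.exp (-P s) * -k s + Real.exp (-P s) * k s = 0 := by ring
      rw [this, zero_smul]
    have h3 : HasDerivAt v
        (Real.exp (-P s) • k s • f (γ s) + (Real.exp (-P s) * -k s) • f (γ s)) s := h2
    rw [add_comm, hzero] at h3
    exact h3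
  have hvd : Differentiable ℝ v := fun s => (hv' s).differentiableAt
  have hconst := is_const_of_deriv_eq_zero hvd (fun s => (hv' s).deriv) t 0
  simp only [hv, hP0, neg_zero, Real.exp_zero, one_smul] at hconst
  refine ⟨Real.exp (P t), Real.exp_pos _, ?_⟩
  have h := congrArg (fun z => Real.exp (P t) • z) hconst
  simp only [smul_smul] at h
  rwa [show Real.exp (P t) * Real.exp (-P t) = 1 by rw [← Real.exp_add, add_neg_cancel,
    Real.exp_zero], one_smul] at h

end Invariants

/-! ### §3 The directed isotopy lemma -/

section Main

variable [FiniteDimensional ℝ E]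

/-- **A regular family of compact domains is carried by the flow of any field transverse to the
moving part of the hypersurfaces.**  Let `F : ℝ × E → ℝ` and the field `Y : E → E` be `C^∞` on
a finite-dimensional real normed space, `K` compact and `C` closed, and suppose that for every
`τ ∈ [0, 1]`: the band `{|F_τ| ≤ ε₀}` lies in `K`; `∂_τ F(τ, x) = 0` for `x ∉ C` (the
hypersurfaces `{F_τ = 0}` move only inside `C`); and the derivative of `F_τ = F(τ, ·)` does not
vanish on `Y` at the points of `C ∩ {F_τ = 0}` (`DF_τ(x)(Y x) ≠ 0`: `Y` is transverse to the
moving part of the hypersurface — off `C` it may well be tangent to it).  Then there is a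
diffeomorphism `Φ` of `E` (the time-`1` map of the compactly supported time-dependent field
`X = -χ(F_τ) ∂_τF_τ · Y / DF_τ(Y)`, extended by `0` off `C`, along which `F_τ` is frozen near the
zero sets) with `sign F_1(Φ x) = sign F_0(x)` for every `x` (three clauses), fixing every point
outside `K` and every point at which `∂_τ F` vanishes for all `τ ∈ [0, 1]` (in particular every
point outside `C`), and MOVING EVERY POINT ALONG ITS `Y`-ORBIT: for every `x` there are a curve
`γ` and a continuous `κ : ℝ → ℝ` with `γ 0 = x`, `γ 1 = Φ x` and `γ' t = κ t • Y (γ t)` for all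
`t` (so conserved quantities and eigenfunctions of `Y` behave under `Φ` as in §2).  (Milnor
1963, proof of Thm. 3.1; Hirsch 1976, Ch. 8 §1 and Ch. 6 §2, with the gradient replaced by a
transverse field.) [folklore] -/
theorem exists_diffeomorph_sign_eq_of_field_on {F : ℝ × E → ℝ} (hF : ContDiff ℝ ∞ F)
    {Y : E → E} (hY : ContDiff ℝ ∞ Y) {K : Set E} (hK : IsCompact K) {C : Set E}
    (hC : IsClosed C) {ε₀ : ℝ} (hε₀ : 0 < ε₀)
    (hKF : ∀ τ ∈ Icc (0 : ℝ) 1, ∀ x, |F (τ, x)| ≤ ε₀ → x ∈ K)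
    (hstat : ∀ τ ∈ Icc (0 : ℝ) 1, ∀ x, x ∉ C → fderiv ℝ F (τ, x) (1, 0) = 0)
    (hreg : ∀ τ ∈ Icc (0 : ℝ) 1, ∀ x ∈ C, F (τ, x) = 0 →
      fderiv ℝ (fun y => F (τ, y)) x (Y x) ≠ 0) :
    ∃ Φ : E ≃ₘ⟮𝓘(ℝ, E), 𝓘(ℝ, E)⟯ E,
      (∀ x, F (1, Φ x) < 0 ↔ F (0, x) < 0) ∧ (∀ x, F (1, Φ x) = 0 ↔ F (0, x) = 0) ∧
      (∀ x, 0 < F (1, Φ x) ↔ 0 < F (0, x)) ∧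
      (∀ x, (∀ τ ∈ Icc (0 : ℝ) 1, fderiv ℝ F (τ, x) (1, 0) = 0) → Φ x = x) ∧
      (∀ x, x ∉ K → Φ x = x) ∧
      (∀ x, ∃ (γ : ℝ → E) (κ : ℝ → ℝ), Continuous κ ∧ γ 0 = x ∧ γ 1 = Φ x ∧
        ∀ t, HasDerivAt γ (κ t • Y (γ t)) t) := by
  haveI : CompleteSpace E := FiniteDimensional.complete ℝ E
  -- uniform constants (on `C`)
  obtain ⟨μ, hμ, ε, hε, hεε₀, hbound⟩ :=
    exists_forall_le_abs_fderiv_apply_on (hF.of_le (by norm_cast)) hY.continuous hK hC hε₀ hKF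
      hreg
  -- the cutoff
  have hab : ε / 3 < ε / 2 := by linarith
  obtain ⟨hχs, hχ1, hχ0⟩ := plateauCutoff_props hab
  set χ : ℝ → ℝ := fun s => Real.smoothTransition ((s + ε / 2) / (ε / 2 - ε / 3)) *
    Real.smoothTransition ((ε / 2 - s) / (ε / 2 - ε / 3)) with hχdef
  -- the reparametrised family
  set ST := Real.smoothTransition with hST
  have hST01 : ∀ τ, ST τ ∈ Icc (0 : ℝ) 1 :=
    fun τ => ⟨Real.smoothTransition.nonneg τ, Real.smoothTransition.le_one τ⟩
  set G : ℝ × E → ℝ := fun p => F (ST p.1, p.2) with hGdef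
  have hGs : ContDiff ℝ ∞ G :=
    hF.comp ((Real.smoothTransition.contDiff.comp contDiff_fst).prodMk contDiff_snd)
  have hGd : Differentiable ℝ G := hGs.differentiable (by simp)
  -- spatial derivative
  set A : ℝ × E → (E →L[ℝ] ℝ) := fun p => (fderiv ℝ G p).comp (ContinuousLinearMap.inr ℝ ℝ E)
    with hAdef
  have hA : ∀ p : ℝ × E, fderiv ℝ (fun y => G (p.1, y)) p.2 = A p := by
    intro p
    have h := (hGd (p.1, p.2)).hasFDerivAt.comp p.2 (hasFDerivAt_prodMk_right (𝕜 := ℝ) p.1 p.2)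
    exact h.fderiv
  have hAs : ContDiff ℝ ∞ A :=
    ((ContinuousLinearMap.compL ℝ E (ℝ × E) ℝ).flip (ContinuousLinearMap.inr ℝ ℝ E)).contDiff.comp
      (hGs.fderiv_right (m := ∞) le_rfl)
  -- the directional derivative `dG(Y)`
  set dY : ℝ × E → ℝ := fun p => A p (Y p.2) with hdYdef
  have hdYs : ContDiff ℝ ∞ dY := hAs.clm_apply (hY.comp contDiff_snd)
  -- time derivative
  set b : ℝ × E → ℝ := fun p => fderiv ℝ G p (1, 0) with hbdef
  have hbs : ContDiff ℝ ∞ b :=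
    (ContinuousLinearMap.apply ℝ ℝ ((1 : ℝ), (0 : E))).contDiff.comp (hGs.fderiv_right (m := ∞) le_rfl)
  -- the bound for `G` on `C`: `|G p| ≤ ε → μ ≤ |dY p|`
  have hboundG : ∀ p : ℝ × E, p.2 ∈ C → |G p| ≤ ε → μ ≤ |dY p| := by
    intro p hpC hp
    have h := hbound (ST p.1) (hST01 p.1) p.2 hpC hp
    rwa [show fderiv ℝ (fun y => F (ST p.1, y)) p.2 = A p from hA p] at h
  -- the time derivative in terms of `F`
  have hb_formula : ∀ p : ℝ × E, b p = deriv ST p.1 * fderiv ℝ F (ST p.1, p.2) (1, 0) := by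
    rintro ⟨τ, x⟩
    have hFd : DifferentiableAt ℝ F (ST τ, x) := hF.differentiable (by simp) _
    have hc1 : HasDerivAt (fun σ : ℝ => ((σ, x) : ℝ × E)) ((1 : ℝ), (0 : E)) τ :=
      (hasDerivAt_id τ).prodMk (hasDerivAt_const τ x)
    have h1 : HasDerivAt (G ∘ fun σ : ℝ => ((σ, x) : ℝ × E)) (fderiv ℝ G (τ, x) ((1 : ℝ), (0 : E))) τ :=
      (hGd (τ, x)).hasFDerivAt.comp_hasDerivAt τ hc1
    have hSTd : HasDerivAt ST (deriv ST τ) τ :=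
      (Real.smoothTransition.contDiff (n := 1)).differentiable one_ne_zero _ |>.hasDerivAt
    have hc2 : HasDerivAt (fun σ : ℝ => ((ST σ, x) : ℝ × E)) ((deriv ST τ, (0 : E)) : ℝ × E) τ :=
      hSTd.prodMk (hasDerivAt_const τ x)
    have h2 : HasDerivAt (F ∘ fun σ : ℝ => ((ST σ, x) : ℝ × E))
        (fderiv ℝ F (ST τ, x) ((deriv ST τ, (0 : E)) : ℝ × E)) τ :=
      hFd.hasFDerivAt.comp_hasDerivAt τ hc2
    have h12 : (G ∘ fun σ : ℝ => ((σ, x) : ℝ × E)) = (F ∘ fun σ : ℝ => ((ST σ, x) : ℝ × E)) := by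
      funext σ; rfl
    rw [h12] at h1
    have heq := h1.unique h2
    show fderiv ℝ G (τ, x) ((1 : ℝ), (0 : E)) = deriv ST τ * fderiv ℝ F (ST τ, x) (1, 0)
    rw [heq, show ((deriv ST τ, (0 : E)) : ℝ × E) = deriv ST τ • ((1 : ℝ), (0 : E)) by simp,
      map_smul, smul_eq_mul]
  -- off the moving set the time derivative vanishes, locally uniformly
  have hb0 : ∀ p : ℝ × E, p.2 ∉ C → b p = 0 := fun p hp => by
    rw [hb_formula, hstat (ST p.1) (hST01 p.1) p.2 hp, mul_zero]
  have hb0_nhds : ∀ p : ℝ × E, p.2 ∉ C → ∀ᶠ q in 𝓝 p, b q = 0 := by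
    intro p hp
    have hev : ∀ᶠ q in 𝓝 p, q.2 ∉ C :=
      (continuous_snd.continuousAt (x := p)).eventually (hC.isOpen_compl.mem_nhds hp)
    exact hev.mono fun q hq => hb0 q hq
  -- `χ ∘ G` vanishes near points of the moving set where `dY = 0`
  have hχG0 : ∀ p : ℝ × E, p.2 ∈ C → dY p = 0 → ∀ᶠ q in 𝓝 p, χ (G q) = 0 := by
    intro p hpC hp
    have hGp : ε < |G p| := by
      by_contra hle
      push Not at hle
      have := hboundG p hpC hle
      rw [hp, abs_zero] at this
      linarith
    have h1 : ε / 2 < |G p| := by linarith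
    have hev : ∀ᶠ q in 𝓝 p, ε / 2 < |G q| :=
      (continuous_abs.comp hGs.continuous).continuousAt.eventually_const_lt h1
    exact hev.mono fun q hq => hχ0 _ hq.le
  -- the scalar coefficient and the field
  set c : ℝ × E → ℝ := fun p => -(χ (G p) * b p / dY p) with hcdef
  set X : ℝ × E → E := fun p => c p • Y p.2 with hXdef
  -- smoothness of the coefficient and of the field
  have hcs : ContDiff ℝ ∞ c := by
    rw [contDiff_iff_contDiffAt]
    intro p
    by_cases hp : dY p = 0
    · -- near such a point `c = 0`: off `C` because `b = 0`, on `C` because `χ ∘ G = 0`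
      have hev : c =ᶠ[𝓝 p] fun _ => 0 := by
        by_cases hpC : p.2 ∈ C
        · exact (hχG0 p hpC hp).mono fun q hq => by
            simp only [hcdef, hq, zero_mul, zero_div, neg_zero]
        · exact (hb0_nhds p hpC).mono fun q hq => by
            simp only [hcdef, hq, mul_zero, zero_div, neg_zero]
      exact (contDiffAt_const.congr_of_eventuallyEq hev)
    · have h1 : ContDiffAt ℝ ∞ (fun q => (dY q)⁻¹) p := hdYs.contDiffAt.inv hp
      have h2 : ContDiffAt ℝ ∞ (fun q => χ (G q) * b q * (dY q)⁻¹) p :=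
        (((hχs.comp hGs).contDiffAt).mul hbs.contDiffAt).mul h1
      refine (h2.neg).congr_of_eventuallyEq (Eventually.of_forall fun q => ?_)
      simp only [hcdef, div_eq_mul_inv]
  have hXs : ContDiff ℝ ∞ X := hcs.smul (hY.comp contDiff_snd)
  -- the field vanishes where `b = 0` or `χ ∘ G = 0`
  have hX0_of_b : ∀ p, b p = 0 → X p = 0 := fun p hp => by
    simp only [hXdef, hcdef, hp, mul_zero, zero_div, neg_zero, zero_smul]
  have hc0_of_χ : ∀ p, χ (G p) = 0 → c p = 0 := fun p hp => by
    simp only [hcdef, hp, zero_mul, zero_div, neg_zero]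
  have hX0_of_χ : ∀ p, χ (G p) = 0 → X p = 0 := fun p hp => by
    simp only [hXdef, hc0_of_χ p hp, zero_smul]
  have hχG0_of_notMem : ∀ p : ℝ × E, p.2 ∉ K → χ (G p) = 0 := by
    intro p hp
    apply hχ0
    by_contra hlt
    push Not at hlt
    exact hp (hKF (ST p.1) (hST01 p.1) p.2 (by linarith [hεε₀] : |F (ST p.1, p.2)| ≤ ε₀))
  -- compact support
  have hXsupp : HasCompactSupport X := by
    refine HasCompactSupport.intro (isCompact_Icc.prod hK : IsCompact (Icc (0 : ℝ) 1 ×ˢ K))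
      fun p hp => ?_
    rw [mem_prod, not_and_or] at hp
    rcases hp with hp | hp
    · apply hX0_of_b
      rw [hb_formula]
      have : deriv ST p.1 = 0 := by
        apply deriv_smoothTransition_eq_zero
        rcases not_and_or.1 (show ¬(0 ≤ p.1 ∧ p.1 ≤ 1) from hp) with h | h
        · exact Or.inl (not_le.1 h).le
        · exact Or.inr (not_le.1 h).le
      rw [this, zero_mul]
    · exact hX0_of_χ p (hχG0_of_notMem p hp)
  -- the flow
  have hn : (1 : ℕ∞) ≤ ⊤ := le_top
  set Φ := Literature.Analysis.ODE.tdFlowDiffeomorph hXs hXsupp hn 0 1 with hΦdef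
  -- flow lines: `g(τ) = G(τ, γ τ)` satisfies `g' = b (1 - χ ∘ g)`
  have hline : ∀ x : E, ∀ τ, HasDerivAt (fun τ => G (τ, Literature.Analysis.ODE.tdFlow hXs hXsupp hn 0 τ x))
      (b (τ, Literature.Analysis.ODE.tdFlow hXs hXsupp hn 0 τ x) *
        (1 - χ (G (τ, Literature.Analysis.ODE.tdFlow hXs hXsupp hn 0 τ x)))) τ := by
    intro x τ
    set γ : ℝ → E := fun τ => Literature.Analysis.ODE.tdFlow hXs hXsupp hn 0 τ x with hγ
    have hγd : HasDerivAt γ (X (τ, γ τ)) τ := Literature.Analysis.ODE.hasDerivAt_tdFlow hXs hXsupp hn 0 x τ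
    have hcurve : HasDerivAt (fun τ : ℝ => ((τ, γ τ) : ℝ × E)) ((1 : ℝ), X (τ, γ τ)) τ :=
      (hasDerivAt_id τ).prodMk hγd
    have h := (hGd (τ, γ τ)).hasFDerivAt.comp_hasDerivAt τ hcurve
    have hval : fderiv ℝ G (τ, γ τ) ((1 : ℝ), X (τ, γ τ)) =
        b (τ, γ τ) * (1 - χ (G (τ, γ τ))) := by
      set p : ℝ × E := (τ, γ τ) with hpdef
      have hsplit : ((1 : ℝ), X p) = ((1 : ℝ), (0 : E)) + ((0 : ℝ), X p) := by simp
      rw [hsplit, map_add]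
      have hAp : fderiv ℝ G p ((0 : ℝ), X p) = A p (X p) := by
        simp only [hAdef, ContinuousLinearMap.comp_apply, ContinuousLinearMap.inr_apply]
      rw [hAp, show fderiv ℝ G p ((1 : ℝ), (0 : E)) = b p from rfl]
      by_cases hbp : b p = 0
      · -- stationary point (e.g. off `C`): both sides vanish
        rw [hX0_of_b p hbp, map_zero, hbp]
        ring
      · have hpC : p.2 ∈ C := by
          by_contra hpC
          exact hbp (hb0 p hpC)
        by_cases hp0 : dY p = 0
        · have hχ0' : χ (G p) = 0 := (hχG0 p hpC hp0).self_of_nhds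
          rw [hX0_of_χ p hχ0', map_zero, hχ0']
          ring
        · have hAX : A p (X p) = c p * dY p := by
            simp only [hXdef, hdYdef, map_smul, smul_eq_mul]
          rw [hAX]
          simp only [hcdef]
          field_simp
          ring
    rw [hval] at h
    exact h
  -- consequences along flow lines
  have hΦ1 : ∀ x, Φ x = Literature.Analysis.ODE.tdFlow hXs hXsupp hn 0 1 x := fun x => rfl
  have hG0 : ∀ x, G (0, Literature.Analysis.ODE.tdFlow hXs hXsupp hn 0 0 x) = F (0, x) := by
    intro x
    rw [Literature.Analysis.ODE.tdFlow_self]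
    simp [hGdef, hST, Real.smoothTransition.zero]
  have hG1 : ∀ x, G (1, Literature.Analysis.ODE.tdFlow hXs hXsupp hn 0 1 x) = F (1, Φ x) := by
    intro x
    simp [hGdef, hST, Real.smoothTransition.one, hΦ1]
  have hχ1' : ∀ s, |s| ≤ ε / 3 → χ s = 1 := hχ1
  have hfrozen : ∀ x, |F (0, x)| ≤ ε / 4 → F (1, Φ x) = F (0, x) := by
    intro x hx
    have := eq_of_hasDerivAt_mul_one_sub (hline x) hχ1' (τ₀ := 0)
      (by rw [hG0]; linarith [hx])
    rw [← hG1, ← hG0, this 1]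
  have hupper : ∀ x, ε / 4 ≤ F (0, x) → ε / 4 ≤ F (1, Φ x) := by
    intro x hx
    have := le_of_hasDerivAt_mul_one_sub (hline x) hχ1' (e' := ε / 4) (by positivity)
      (by linarith) (τ₀ := 0) (by rw [hG0]; exact hx)
    rw [← hG1]; exact this 1
  have hlower : ∀ x, F (0, x) ≤ -(ε / 4) → F (1, Φ x) ≤ -(ε / 4) := by
    intro x hx
    have := le_neg_of_hasDerivAt_mul_one_sub (hline x) hχ1' (e' := ε / 4) (by positivity)
      (by linarith) (τ₀ := 0) (by rw [hG0]; exact hx)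
    rw [← hG1]; exact this 1
  have hneg : ∀ x, F (0, x) < 0 → F (1, Φ x) < 0 := by
    intro x hx
    rcases le_or_gt (F (0, x)) (-(ε / 4)) with h | h
    · linarith [hlower x h]
    · rw [hfrozen x (by rw [abs_of_neg hx]; linarith)]; exact hx
  have hzero : ∀ x, F (0, x) = 0 → F (1, Φ x) = 0 := by
    intro x hx
    rw [hfrozen x (by rw [hx, abs_zero]; positivity), hx]
  have hpos : ∀ x, 0 < F (0, x) → 0 < F (1, Φ x) := by
    intro x hx
    rcases le_or_gt (ε / 4) (F (0, x)) with h | h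
    · linarith [hupper x h]
    · rw [hfrozen x (by rw [abs_of_pos hx]; linarith)]; exact hx
  refine ⟨Φ, fun x => ⟨fun h => ?_, hneg x⟩, fun x => ⟨fun h => ?_, hzero x⟩,
    fun x => ⟨fun h => ?_, hpos x⟩, fun x hx => ?_, fun x hx => ?_, fun x => ?_⟩
  · rcases lt_trichotomy (F (0, x)) 0 with h' | h' | h'
    · exact h'
    · linarith [hzero x h']
    · linarith [hpos x h']
  · rcases lt_trichotomy (F (0, x)) 0 with h' | h' | h'
    · linarith [hneg x h']
    · exact h'
    · linarith [hpos x h']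
  · rcases lt_trichotomy (F (0, x)) 0 with h' | h' | h'
    · linarith [hneg x h']
    · linarith [hzero x h']
    · exact h'
  · -- stationary points are fixed
    rw [hΦ1]
    refine Literature.Analysis.ODE.tdFlow_eq_self_of_forall_eq_zero hXs hXsupp hn (fun τ => ?_) 0 1
    apply hX0_of_b
    rw [hb_formula]
    rw [hx (ST τ) (hST01 τ), mul_zero]
  · -- points outside `K` are fixed
    rw [hΦ1]
    exact Literature.Analysis.ODE.tdFlow_eq_self_of_forall_eq_zero hXs hXsupp hn
      (fun τ => hX0_of_χ _ (hχG0_of_notMem (τ, x) hx)) 0 1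
  · -- the orbit clause: the flow line through `x` is directed by `Y`
    set γ : ℝ → E := fun τ => Literature.Analysis.ODE.tdFlow hXs hXsupp hn 0 τ x with hγ
    have hγd : ∀ τ, HasDerivAt γ (X (τ, γ τ)) τ :=
      fun τ => Literature.Analysis.ODE.hasDerivAt_tdFlow hXs hXsupp hn 0 x τ
    have hγc : Continuous γ := continuous_iff_continuousAt.2 fun τ => (hγd τ).continuousAt
    refine ⟨γ, fun τ => c (τ, γ τ), hcs.continuous.comp (continuous_id.prodMk hγc), ?_, ?_,
      fun τ => ?_⟩
    · simp [hγ]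
    · simp [hγ, hΦ1]
    · exact hγd τ

/-- **A regular family of compact domains is carried by the flow of any transverse field**
(the case `C = univ` of `exists_diffeomorph_sign_eq_of_field_on`).  Let `F : ℝ × E → ℝ` and the
field `Y : E → E` be `C^∞` on a finite-dimensional real normed space, and suppose that for every
`τ ∈ [0, 1]` the derivative of `F_τ = F(τ, ·)` does not vanish on `Y` along the zero set of `F_τ`
(`DF_τ(x)(Y x) ≠ 0`: `Y` is transverse to the moving hypersurface) and the band `{|F_τ| ≤ ε₀}`
lies in a fixed compact set `K`.  Then there is a diffeomorphism `Φ` of `E` (the time-`1` map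
of the compactly supported time-dependent field `X = -χ(F_τ) ∂_τF_τ · Y / DF_τ(Y)`, along which
`F_τ` is frozen near the zero sets) with `sign F_1(Φ x) = sign F_0(x)` for every `x` (three
clauses), fixing every point outside `K` and every point at which `∂_τ F` vanishes for all
`τ ∈ [0, 1]`, and MOVING EVERY POINT ALONG ITS `Y`-ORBIT: for every `x` there are a curve `γ`
and a continuous `κ : ℝ → ℝ` with `γ 0 = x`, `γ 1 = Φ x` and `γ' t = κ t • Y (γ t)` for all `t`
(so conserved quantities and eigenfunctions of `Y` behave under `Φ` as in §2).  (Milnor 1963,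
proof of Thm. 3.1; Hirsch 1976, Ch. 8 §1 and Ch. 6 §2, with the gradient replaced by a
transverse field.) [folklore] -/
theorem exists_diffeomorph_sign_eq_of_field {F : ℝ × E → ℝ} (hF : ContDiff ℝ ∞ F) {Y : E → E}
    (hY : ContDiff ℝ ∞ Y) {K : Set E} (hK : IsCompact K) {ε₀ : ℝ} (hε₀ : 0 < ε₀)
    (hKF : ∀ τ ∈ Icc (0 : ℝ) 1, ∀ x, |F (τ, x)| ≤ ε₀ → x ∈ K)
    (hreg : ∀ τ ∈ Icc (0 : ℝ) 1, ∀ x, F (τ, x) = 0 → fderiv ℝ (fun y => F (τ, y)) x (Y x) ≠ 0) :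
    ∃ Φ : E ≃ₘ⟮𝓘(ℝ, E), 𝓘(ℝ, E)⟯ E,
      (∀ x, F (1, Φ x) < 0 ↔ F (0, x) < 0) ∧ (∀ x, F (1, Φ x) = 0 ↔ F (0, x) = 0) ∧
      (∀ x, 0 < F (1, Φ x) ↔ 0 < F (0, x)) ∧
      (∀ x, (∀ τ ∈ Icc (0 : ℝ) 1, fderiv ℝ F (τ, x) (1, 0) = 0) → Φ x = x) ∧
      (∀ x, x ∉ K → Φ x = x) ∧
      (∀ x, ∃ (γ : ℝ → E) (κ : ℝ → ℝ), Continuous κ ∧ γ 0 = x ∧ γ 1 = Φ x ∧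
        ∀ t, HasDerivAt γ (κ t • Y (γ t)) t) :=
  exists_diffeomorph_sign_eq_of_field_on hF hY hK isClosed_univ hε₀ hKF
    (fun _ _ x hx => (hx (mem_univ x)).elim) (fun τ hτ x _ hx => hreg τ hτ x hx)

/-- **Image form, with a moving set.** Under the hypotheses of
`exists_diffeomorph_sign_eq_of_field_on`, the diffeomorphism carries the domain `{F_0 ≤ 0}`
onto `{F_1 ≤ 0}`, the hypersurface `{F_0 = 0}` onto `{F_1 = 0}` and the open sides onto each
other, fixes the stationary points (in particular the points outside `C`) and the points outside
`K`, and moves every point along its `Y`-orbit. [folklore] -/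
theorem exists_diffeomorph_image_eq_of_field_on {F : ℝ × E → ℝ} (hF : ContDiff ℝ ∞ F)
    {Y : E → E} (hY : ContDiff ℝ ∞ Y) {K : Set E} (hK : IsCompact K) {C : Set E}
    (hC : IsClosed C) {ε₀ : ℝ} (hε₀ : 0 < ε₀)
    (hKF : ∀ τ ∈ Icc (0 : ℝ) 1, ∀ x, |F (τ, x)| ≤ ε₀ → x ∈ K)
    (hstat : ∀ τ ∈ Icc (0 : ℝ) 1, ∀ x, x ∉ C → fderiv ℝ F (τ, x) (1, 0) = 0)
    (hreg : ∀ τ ∈ Icc (0 : ℝ) 1, ∀ x ∈ C, F (τ, x) = 0 →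
      fderiv ℝ (fun y => F (τ, y)) x (Y x) ≠ 0) :
    ∃ Φ : E ≃ₘ⟮𝓘(ℝ, E), 𝓘(ℝ, E)⟯ E,
      Φ '' {x | F (0, x) ≤ 0} = {x | F (1, x) ≤ 0} ∧ Φ '' {x | F (0, x) = 0} = {x | F (1, x) = 0} ∧
      Φ '' {x | F (0, x) < 0} = {x | F (1, x) < 0} ∧
      (∀ x, (∀ τ ∈ Icc (0 : ℝ) 1, fderiv ℝ F (τ, x) (1, 0) = 0) → Φ x = x) ∧
      (∀ x, x ∉ C → Φ x = x) ∧ (∀ x, x ∉ K → Φ x = x) ∧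
      (∀ x, ∃ (γ : ℝ → E) (κ : ℝ → ℝ), Continuous κ ∧ γ 0 = x ∧ γ 1 = Φ x ∧
        ∀ t, HasDerivAt γ (κ t • Y (γ t)) t) := by
  obtain ⟨Φ, hneg, hzero, hpos, hfix, hK', horb⟩ :=
    exists_diffeomorph_sign_eq_of_field_on hF hY hK hC hε₀ hKF hstat hreg
  have key : ∀ (P : ℝ → Prop), (∀ x, P (F (1, Φ x)) ↔ P (F (0, x))) →
      Φ '' {x | P (F (0, x))} = {x | P (F (1, x))} := by
    intro P hP
    ext y
    simp only [mem_image, mem_setOf_eq]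
    constructor
    · rintro ⟨x, hx, rfl⟩
      exact (hP x).2 hx
    · intro hy
      refine ⟨Φ.symm y, (hP _).1 ?_, Φ.apply_symm_apply y⟩
      rw [Φ.apply_symm_apply]; exact hy
  refine ⟨Φ, key (· ≤ 0) fun x => ?_, key (· = 0) hzero, key (· < 0) hneg, hfix,
    fun x hx => hfix x fun τ hτ => hstat τ hτ x hx, hK', horb⟩
  simp only [le_iff_lt_or_eq]
  exact or_congr (hneg x) (hzero x)

/-- **Image form.** Under the hypotheses of `exists_diffeomorph_sign_eq_of_field`, the
diffeomorphism carries the domain `{F_0 ≤ 0}` onto `{F_1 ≤ 0}`, the hypersurface `{F_0 = 0}` onto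
`{F_1 = 0}` and the open sides onto each other, fixes the stationary points and the points outside
`K`, and moves every point along its `Y`-orbit. [folklore] -/
theorem exists_diffeomorph_image_eq_of_field {F : ℝ × E → ℝ} (hF : ContDiff ℝ ∞ F) {Y : E → E}
    (hY : ContDiff ℝ ∞ Y) {K : Set E} (hK : IsCompact K) {ε₀ : ℝ} (hε₀ : 0 < ε₀)
    (hKF : ∀ τ ∈ Icc (0 : ℝ) 1, ∀ x, |F (τ, x)| ≤ ε₀ → x ∈ K)
    (hreg : ∀ τ ∈ Icc (0 : ℝ) 1, ∀ x, F (τ, x) = 0 → fderiv ℝ (fun y => F (τ, y)) x (Y x) ≠ 0) :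
    ∃ Φ : E ≃ₘ⟮𝓘(ℝ, E), 𝓘(ℝ, E)⟯ E,
      Φ '' {x | F (0, x) ≤ 0} = {x | F (1, x) ≤ 0} ∧ Φ '' {x | F (0, x) = 0} = {x | F (1, x) = 0} ∧
      Φ '' {x | F (0, x) < 0} = {x | F (1, x) < 0} ∧
      (∀ x, (∀ τ ∈ Icc (0 : ℝ) 1, fderiv ℝ F (τ, x) (1, 0) = 0) → Φ x = x) ∧
      (∀ x, x ∉ K → Φ x = x) ∧
      (∀ x, ∃ (γ : ℝ → E) (κ : ℝ → ℝ), Continuous κ ∧ γ 0 = x ∧ γ 1 = Φ x ∧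
        ∀ t, HasDerivAt γ (κ t • Y (γ t)) t) := by
  obtain ⟨Φ, hneg, hzero, hpos, hfix, hK', horb⟩ :=
    exists_diffeomorph_sign_eq_of_field hF hY hK hε₀ hKF hreg
  have key : ∀ (P : ℝ → Prop), (∀ x, P (F (1, Φ x)) ↔ P (F (0, x))) →
      Φ '' {x | P (F (0, x))} = {x | P (F (1, x))} := by
    intro P hP
    ext y
    simp only [mem_image, mem_setOf_eq]
    constructor
    · rintro ⟨x, hx, rfl⟩
      exact (hP x).2 hx
    · intro hy
      refine ⟨Φ.symm y, (hP _).1 ?_, Φ.apply_symm_apply y⟩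
      rw [Φ.apply_symm_apply]; exact hy
  refine ⟨Φ, key (· ≤ 0) fun x => ?_, key (· = 0) hzero, key (· < 0) hneg, hfix, hK', horb⟩
  simp only [le_iff_lt_or_eq]
  exact or_congr (hneg x) (hzero x)

/-- **Packaged form: images, conserved quantities and one eigenfunction.**  Under the hypotheses
of `exists_diffeomorph_sign_eq_of_field`, given moreover a differentiable `f : E → V` with
`df_x(Y x) = a(x) • f(x)` (`a` continuous; e.g. a complex coordinate function `w` with
`dw(Y) = -μ w`), the diffeomorphism `Φ` with `Φ {F_0 ≤ 0} = {F_1 ≤ 0}`, `Φ {F_0 = 0} = {F_1 = 0}`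
preserves every differentiable conserved quantity `g` of `Y` (`dg(Y) = 0 ⇒ g ∘ Φ = g`) and
multiplies `f` by a positive function (`f (Φ x) = r • f x`, `r > 0`: it preserves `{f = 0}` and,
for `V = ℂ`, the argument `f/‖f‖`). [folklore] -/
theorem exists_diffeomorph_image_eq_of_field_of_eigen {V : Type*} [NormedAddCommGroup V]
    [NormedSpace ℝ V] {F : ℝ × E → ℝ} (hF : ContDiff ℝ ∞ F) {Y : E → E}
    (hY : ContDiff ℝ ∞ Y) {K : Set E} (hK : IsCompact K) {ε₀ : ℝ} (hε₀ : 0 < ε₀)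
    (hKF : ∀ τ ∈ Icc (0 : ℝ) 1, ∀ x, |F (τ, x)| ≤ ε₀ → x ∈ K)
    (hreg : ∀ τ ∈ Icc (0 : ℝ) 1, ∀ x, F (τ, x) = 0 → fderiv ℝ (fun y => F (τ, y)) x (Y x) ≠ 0)
    {f : E → V} (hf : Differentiable ℝ f) {a : E → ℝ} (ha : Continuous a)
    (hfY : ∀ x, fderiv ℝ f x (Y x) = a x • f x) :
    ∃ Φ : E ≃ₘ⟮𝓘(ℝ, E), 𝓘(ℝ, E)⟯ E,
      Φ '' {x | F (0, x) ≤ 0} = {x | F (1, x) ≤ 0} ∧ Φ '' {x | F (0, x) = 0} = {x | F (1, x) = 0} ∧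
      (∀ x, x ∉ K → Φ x = x) ∧
      (∀ g : E → ℝ, Differentiable ℝ g → (∀ x, fderiv ℝ g x (Y x) = 0) → ∀ x, g (Φ x) = g x) ∧
      (∀ x, ∃ r : ℝ, 0 < r ∧ f (Φ x) = r • f x) := by
  obtain ⟨Φ, hle, heq, -, -, hK', horb⟩ :=
    exists_diffeomorph_image_eq_of_field hF hY hK hε₀ hKF hreg
  refine ⟨Φ, hle, heq, hK', fun g hg hgY x => ?_, fun x => ?_⟩
  · obtain ⟨γ, κ, -, h0, h1, hγ⟩ := horb x
    rw [← h1, ← h0]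
    exact apply_eq_apply_of_hasDerivAt_smul hg hgY hγ 1
  · obtain ⟨γ, κ, hκ, h0, h1, hγ⟩ := horb x
    rw [← h1, ← h0]
    exact exists_pos_apply_eq_smul_of_hasDerivAt_smul hf ha hfY hκ hγ 1

end Main

end RegularFamily

end Literature.Topology.FourManifolds

end
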